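import Summits.BirchSwinnertonDyer.BirchSwinnertonDyer.Theorems.ManinLocalTwoThreeManinPrimeToAdditiveFiveLeRedFiveSevenSharpSplit
import Summits.BirchSwinnertonDyer.BirchSwinnertonDyer.Theorems.ManinLocalTwoThreeManinPrimeToAdditiveFiveLeUpperAnchorOfFacts
import Summits.BirchSwinnertonDyer.BirchSwinnertonDyer.Theorems.KatoDescentTamePotSupersingularTameDefectIsogenyInvariance
import HarnessLib

/-!
# Route `ManinLocalTwoThree`, residual crux C5 `ManinPrimeToAdditiveFiveLe`
# (stmt-BirchSwinnertonDyer-22969), line `upper_anchor` (skeleton v6, registered stub `stub_red57unstarred`):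
# **the Kodaira-II cell at `p = 5` of the reducible unstarred residue rides its FLIP TWIN of type IV**

Lead seat bsd-line-ml23-c5-p1 (gen 4). The registered stub `stub_red57unstarred` of skeleton v6
(`Cruxes/ManinPrimeToAdditiveFiveLe/Lines/upper_anchor.lean`, sha16 792ced1148944399) is RED(57♯) on the
UNSTARRED side: `p ∈ {5, 7}`, `W[p]` reducible, `p² ∣ N(W) > 5·10⁵`, globally twist-minimal, `p ∣ deg φ`,
no `Iₙ*` fibre, `ord_p Δ_min(W) ≤ 4` (Kodaira II/III/IV), lattice-optimal conductor-level datum `D` ⟹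
`p ∤ c(D)`. Among its cells the one of Kodaira type II at `p = 5` (`ord₅ Δ_min = 2`, tame index `e = 6`) is
the only one where even Edixhoven's METHOD is void (Raynaud's `e < p − 1` fails: `6 > 4`), while its
`χ₅`-twist twin of type IV (`e = 3 < 4`) is inside Raynaud's range.

THIS FILE proves, kernel-checked and WITHOUT any new printed input, that the type-II cell at `5` is carried
by the rest of the stub (the cells `(5; III)`, `(5; IV)`, `(7; II/III/IV)`) and Česnavičius–Neururer–Saha
Thm. 1.2 (cite-only fact, already an input of the line), up to an in-range-EMPTY corner:

* `coreRED57unstarred_of_cns_of_offTypeIIAtFive_of_typeIIAtFiveCorner` —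
  **RED(57♯)[unstarred] ⟸ ČNS ∧ RED(57♯)[unstarred, off `(p, ord_p Δ_min) = (5, 2)`] ∧ CORNER(5; II)**, where
  CORNER(5; II) is RED(57♯)[unstarred] restricted to `p = 5`, `ord₅ Δ_min(W) = 2` AND «every lattice-optimal
  globally minimal `W₀ ∼ W ⊗ χ₅` is starred (`4 < ord₅ Δ_min(W₀)`)».

PROOF. Let `W` be of type II at `5` with all the cuts, `W₀` the lattice-optimal curve of the class of
`W ⊗ 5` (modularity + Edixhoven Prop. 2, `exists_isIsogenous_latticeOptimal`). Off the corner some such `W₀`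
is unstarred (`ord₅ Δ_min(W₀) ≤ 4`). Twist-minimality of `W` at `5` gives `25 ∣ N(W₀)`, hence
`N(W₀) = N(W)`; the cuts transfer to `W₀` (`…ReducibleTwistTransport` §3; reducibility along
`W ∼ W₀ ⊗ 5`; no `Iₙ*` since `W₀` is additive with `ord₅ Δ_min ≤ 4`; `5 ∣ deg(D₀)` or else ČNS closes `W₀`).
The globally minimal model `C′` of `W₀ ⊗ 5` has `ord₅ Δ_min(C′) = ord₅ Δ_min(W₀) + 6`
(`padicValInt_minimalDiscriminantInt_twist_pm_p_of_lt_six`) and `W ∼ C′`, so the PROVED isogeny invariance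
of the tame index (`TameDefectIsogenyInvariance.gcd_padicValInt_minimalDiscriminantInt_eq_of_isIsogenous`,
Serre–Tate) gives `gcd(12, ord₅ Δ_min(W₀) + 6) = gcd(12, 2) = 2`, i.e. `ord₅ Δ_min(W₀) = 4`: **the twin is
of type IV**, in particular off the type-II cell, so the second hypothesis yields `5 ∤ c(D₀)`. Finally both
`W` and `W₀` are unstarred, so the globally minimal models `C`, `C′` of `W ⊗ 5`, `W₀ ⊗ 5` satisfy
`Δ(C) = 5⁶ Δ(W)`, `Δ(C′) = 5⁶ Δ(W₀)` (`Δ_eq_pStar_pow_six_mul_Δ_of_padicValInt_lt_six`), and the an-cell's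
PROVED THM II on flip orbits (`flipOrbitManinEq_pStar`: Stevens (5.2)/(5.4) both ways) gives
`c(D₀) = ±c(D)`. Hence `5 ∤ c(D)`.

WHY THIS IS THE RIGHT CUT (cell census, `N ≤ 5·10⁵`, HOME `data/TWISTCENSUS2-rows-v1.tsv.gz` sha256
43352cbe…, engine 2 = PARI + ecdata, two-engine agreement 577 946 / 578 278 on `N < 10⁵`; non-CM same-`N`
`χ_{p*}`-orbit rows with a `p`-isogeny, i.e. the `W[p]`-reducible locus of RED(57♯)):
`p = 5`: (II → twist IV* → optimal partner IV) 771 rows and (IV → II* → II) 771 rows, ALL non-commuting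
(«flips», isogeny degree twist → partner-optimal `5`, Néron scalar `λ = 5`, `v₅(deg′) = v₅(deg)`);
(III → III* → III*) 377 and (III* → III → III) 377 rows, ALL commuting (`v₅(deg′) = v₅(deg) ± 1`).
`p = 7`: (III → III* → III) 122 flips; (II ↔ IV*) 112 + 112 and (IV ↔ II*) 43 + 43 commuting. So on the
reducible locus the potentially supersingular cells (`e ∤ p − 1`: II, IV at `5`; III at `7`) ALWAYS flip with
BOTH optimal curves unstarred, and the potentially ordinary cells (`e ∣ p − 1`) always commute — in range.
Consequences recorded for the planner (not formalised beyond this file): (i) a «degree goes up / optimality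
commutes with `⊗ p*`» stub at `p ∈ {5, 7}` on the reducible locus (the shape of gen 3's `DegreeUp13Red`) is
REFUTED in range (1 542 + 122 flip rows) — do not file it; (ii) CORNER(5; II) is EMPTY in range (0 / 771: the
optimal curve of the twin class of a type-II reducible optimal curve is always the type-IV member); (iii) in
CORNER(5; II) the pair `(W, W₀ ≅ W ⊗ 5)` commutes, and the cell's PROVED near-invariance
(`pStar_optimal_commuting_manin_near_invariance`) leaves `v₅ c(D) = v₅ c(D₀)` (then `W` is equivalent to its
STARRED twin IV*, `e = 3`, Edixhoven's starred mechanism) or `v₅ c(D) = v₅ c(D₀) + 1 ≥ 1` (degree down: C5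
would fail outright); (iv) after this file the cells of RED(57♯)[unstarred] that any port of Edixhoven's
method to `p = 5` must treat are (5; III) (Kosters–Pannekoek corner `e = 4 = p − 1`, potentially ordinary,
commuting) and (5; IV) (`e = 3`, potentially supersingular, flips), never (5; II).

HONEST STATUS. Conditional result (`--supports`, helper): a reduction between OPEN statements plus one
cite-only printed fact (ČNS Thm. 1.2). Nothing here proves `stub_red57unstarred`, C5, Manin's conjecture or BSD.

References: [EdixhovenManin1991] Thm. 3, Props. 7, 9, §4; [Stevens1989] Lemmas (5.2), (5.4); [Pal2012]
Prop. 2.5; [CesnaviciusNeururerSaha2023] Thm. 1.2; [SerreTate1968] §2 Cor. 3; [SilvermanATAEC1994] IV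
Table 4.1; [DokchitserDokchitser2015] Table 1 (tame potentially supersingular `p`-isogenies swap II ↔ II*,
III ↔ III*, IV ↔ IV* — the printed reason the flip twin of II is IV*⊗5 = IV; used here only as commentary,
the proof gets the type from the tame-index invariance).
-/

set_option autoImplicit false
-- the Theorems namespace of this sub repeats the summit name by design (D-0017 nested layout)
set_option linter.dupNamespace false

noncomputable section

open scoped Classical NumberField

namespace Summit.BirchSwinnertonDyer.BirchSwinnertonDyer.Theorems

open WeierstrassCurve IsDedekindDomain IsDedekindDomain.HeightOneSpectrum Rat.HeightOneSpectrum NumberField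
  Literature.NumberTheory.EllipticCurves Literature.NumberTheory.EllipticCurves.ModularForms
  Literature.NumberTheory.EllipticCurves.Rank1Residual
  Literature.NumberTheory.DiophantineGeometry
  Summit.BirchSwinnertonDyer.Rank1Residual.ManinAdditive
  Summit.BirchSwinnertonDyer.Rank1Residual.Additive

/-- **RED(57♯)[unstarred] (= registered `stub_red57unstarred` of skeleton v6, VERBATIM as the conclusion)
⟸ ČNS ∧ RED(57♯)[unstarred, off the cell `(p, ord_p Δ_min) = (5, 2)`] (`hA`) ∧ CORNER(5; II) (`hB`).**
`hA` is `stub_red57unstarred` with the extra hypothesis `p = 5 → ord_p Δ_min(W) ≠ 2` (Kodaira type II at `5`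
excluded); `hB` is `stub_red57unstarred` with the extra hypotheses `p = 5`, `ord₅ Δ_min(W) = 2` and «every
lattice-optimal globally minimal `W₀ ∼ W ⊗ χ₅` has `4 < ord₅ Δ_min(W₀)`» (EMPTY in Cremona's range: 0 / 771).
See the module docstring for the proof (flip twin of type IV by the tame-index invariance, transfer of the
cuts, `c(D₀) = ±c(D)` on flip orbits). Conditional result between OPEN statements; nothing here proves C5.
[cite: Stevens1989, Lemmas (5.2), (5.4)] [cite: CesnaviciusNeururerSaha2023, Thm. 1.2]
[cite: SilvermanATAEC1994, IV Table 4.1] [cite: SerreTate1968, §2 Cor. 3] -/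
theorem coreRED57unstarred_of_cns_of_offTypeIIAtFive_of_typeIIAtFiveCorner
    (hCNS : cesnaviciusNeururerSaha_padicVal_maninConstant_le_modularDegree)
    (hA : mazur_not_dvd_maninConstant_of_odd → abbesUllmo_not_dvd_maninConstant_of_not_dvd_level →
      cesnavicius_not_two_dvd_maninConstant_of_two_dvd_level → exists_isNewformOf →
      ∀ (W : WeierstrassCurve ℚ) [W.IsElliptic] [W.IsGloballyMinimal] [NeZero (W.conductorNorm ℤ)]
        (D : ModularParametrizationData W (W.conductorNorm ℤ)),
        IsLatticeOptimal D → ∀ (p : ℕ) (hp : p.Prime), (p = 5 ∨ p = 7) → p ^ 2 ∣ W.conductorNorm ℤ →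
        ¬ (∃ (W' : WeierstrassCurve ℚ) (q : ℕ), W'.IsElliptic ∧ W'.IsGloballyMinimal ∧ q.Prime ∧
            q ≠ 2 ∧ q ^ 2 ∣ W.conductorNorm ℤ ∧
            IsIsogenous W (W'.quadraticTwist (((-1 : ℤ) ^ (q / 2) * q : ℤ) : ℚ)) ∧
            ¬ q ^ 2 ∣ W'.conductorNorm ℤ) →
        ¬ (∃ (W' : WeierstrassCurve ℚ) (d : ℤ), W'.IsElliptic ∧ W'.IsGloballyMinimal ∧
            (d = -1 ∨ d = 2 ∨ d = -2) ∧ 2 ^ 2 ∣ W.conductorNorm ℤ ∧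
            IsIsogenous W (W'.quadraticTwist (d : ℚ)) ∧ ¬ 2 ^ 2 ∣ W'.conductorNorm ℤ) →
        ¬ W.HasIrreducibleModPGaloisRep p →
        500000 < W.conductorNorm ℤ →
        p ∣ D.modularDegree →
        (∀ n : ℕ, W.kodairaSymbolAt ((Rat.HeightOneSpectrum.primesEquiv (R := ℤ)).symm ⟨p, hp⟩) ≠
          .Istar n) →
        padicValInt p W.minimalDiscriminantInt ≤ 4 →
        (p = 5 → padicValInt p W.minimalDiscriminantInt ≠ 2) →
        ¬ (p : ℤ) ∣ D.maninConstant)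
    (hB : mazur_not_dvd_maninConstant_of_odd → abbesUllmo_not_dvd_maninConstant_of_not_dvd_level →
      cesnavicius_not_two_dvd_maninConstant_of_two_dvd_level → exists_isNewformOf →
      ∀ (W : WeierstrassCurve ℚ) [W.IsElliptic] [W.IsGloballyMinimal] [NeZero (W.conductorNorm ℤ)]
        (D : ModularParametrizationData W (W.conductorNorm ℤ)),
        IsLatticeOptimal D → ∀ (p : ℕ) (hp : p.Prime), (p = 5 ∨ p = 7) → p ^ 2 ∣ W.conductorNorm ℤ →
        ¬ (∃ (W' : WeierstrassCurve ℚ) (q : ℕ), W'.IsElliptic ∧ W'.IsGloballyMinimal ∧ q.Prime ∧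
            q ≠ 2 ∧ q ^ 2 ∣ W.conductorNorm ℤ ∧
            IsIsogenous W (W'.quadraticTwist (((-1 : ℤ) ^ (q / 2) * q : ℤ) : ℚ)) ∧
            ¬ q ^ 2 ∣ W'.conductorNorm ℤ) →
        ¬ (∃ (W' : WeierstrassCurve ℚ) (d : ℤ), W'.IsElliptic ∧ W'.IsGloballyMinimal ∧
            (d = -1 ∨ d = 2 ∨ d = -2) ∧ 2 ^ 2 ∣ W.conductorNorm ℤ ∧
            IsIsogenous W (W'.quadraticTwist (d : ℚ)) ∧ ¬ 2 ^ 2 ∣ W'.conductorNorm ℤ) →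
        ¬ W.HasIrreducibleModPGaloisRep p →
        500000 < W.conductorNorm ℤ →
        p ∣ D.modularDegree →
        (∀ n : ℕ, W.kodairaSymbolAt ((Rat.HeightOneSpectrum.primesEquiv (R := ℤ)).symm ⟨p, hp⟩) ≠
          .Istar n) →
        padicValInt p W.minimalDiscriminantInt ≤ 4 →
        p = 5 → padicValInt p W.minimalDiscriminantInt = 2 →
        (∀ (W₀ : WeierstrassCurve ℚ) [W₀.IsElliptic] [W₀.IsGloballyMinimal] [NeZero (W₀.conductorNorm ℤ)]
            (D₀ : ModularParametrizationData W₀ (W₀.conductorNorm ℤ)), IsLatticeOptimal D₀ →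
            IsIsogenous (W.quadraticTwist ((((-1 : ℤ) ^ (p / 2) * p : ℤ)) : ℚ)) W₀ →
            4 < padicValInt p W₀.minimalDiscriminantInt) →
        ¬ (p : ℤ) ∣ D.maninConstant) :
    mazur_not_dvd_maninConstant_of_odd → abbesUllmo_not_dvd_maninConstant_of_not_dvd_level →
    cesnavicius_not_two_dvd_maninConstant_of_two_dvd_level → exists_isNewformOf →
    ∀ (W : WeierstrassCurve ℚ) [W.IsElliptic] [W.IsGloballyMinimal] [NeZero (W.conductorNorm ℤ)]
      (D : ModularParametrizationData W (W.conductorNorm ℤ)),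
      IsLatticeOptimal D → ∀ (p : ℕ) (hp : p.Prime), (p = 5 ∨ p = 7) → p ^ 2 ∣ W.conductorNorm ℤ →
      ¬ (∃ (W' : WeierstrassCurve ℚ) (q : ℕ), W'.IsElliptic ∧ W'.IsGloballyMinimal ∧ q.Prime ∧
          q ≠ 2 ∧ q ^ 2 ∣ W.conductorNorm ℤ ∧
          IsIsogenous W (W'.quadraticTwist (((-1 : ℤ) ^ (q / 2) * q : ℤ) : ℚ)) ∧
          ¬ q ^ 2 ∣ W'.conductorNorm ℤ) →
      ¬ (∃ (W' : WeierstrassCurve ℚ) (d : ℤ), W'.IsElliptic ∧ W'.IsGloballyMinimal ∧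
          (d = -1 ∨ d = 2 ∨ d = -2) ∧ 2 ^ 2 ∣ W.conductorNorm ℤ ∧
          IsIsogenous W (W'.quadraticTwist (d : ℚ)) ∧ ¬ 2 ^ 2 ∣ W'.conductorNorm ℤ) →
      ¬ W.HasIrreducibleModPGaloisRep p →
      500000 < W.conductorNorm ℤ →
      p ∣ D.modularDegree →
      (∀ n : ℕ, W.kodairaSymbolAt ((Rat.HeightOneSpectrum.primesEquiv (R := ℤ)).symm ⟨p, hp⟩) ≠
        .Istar n) →
      padicValInt p W.minimalDiscriminantInt ≤ 4 →
      ¬ (p : ℤ) ∣ D.maninConstant := by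
  intro hM hAU hC hnf W _ _ _ D hD p hp h57 hpN hodd hdy hred hN hdeg hI hv
  by_cases h2 : p = 5 ∧ padicValInt p W.minimalDiscriminantInt = 2
  swap
  · exact hA hM hAU hC hnf W D hD p hp h57 hpN hodd hdy hred hN hdeg hI hv (fun h5 h2' ↦ h2 ⟨h5, h2'⟩)
  obtain ⟨hp5, hv2⟩ := h2
  by_cases hall : ∀ (W₀ : WeierstrassCurve ℚ) [W₀.IsElliptic] [W₀.IsGloballyMinimal]
      [NeZero (W₀.conductorNorm ℤ)] (D₀ : ModularParametrizationData W₀ (W₀.conductorNorm ℤ)),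
      IsLatticeOptimal D₀ → IsIsogenous (W.quadraticTwist ((((-1 : ℤ) ^ (p / 2) * p : ℤ)) : ℚ)) W₀ →
      4 < padicValInt p W₀.minimalDiscriminantInt
  · exact hB hM hAU hC hnf W D hD p hp h57 hpN hodd hdy hred hN hdeg hI hv hp5 hv2 hall
  -- off the corner: an UNSTARRED lattice-optimal `W₀ ∼ W ⊗ p*` (the flip twin)
  simp only [not_forall, not_lt, exists_prop] at hall
  obtain ⟨W₀, hE₀, hM₀, hne₀, D₀, hD₀, hiso, hv₀⟩ := hall
  haveI hpF : Fact p.Prime := ⟨hp⟩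
  have h5 : 5 ≤ p := by omega
  have hp2 : p ≠ 2 := by omega
  obtain ⟨-, hd⟩ := pStar_intCast p
  have hd0 : ((((-1 : ℤ) ^ (p / 2) * p : ℤ)) : ℚ) ≠ 0 := by
    push_cast
    exact mul_ne_zero (pow_ne_zero _ (by norm_num)) (by exact_mod_cast hp.ne_zero)
  haveI : (W.quadraticTwist ((((-1 : ℤ) ^ (p / 2) * p : ℤ)) : ℚ)).IsElliptic := W.isElliptic_quadraticTwist hd0
  haveI : (W₀.quadraticTwist ((((-1 : ℤ) ^ (p / 2) * p : ℤ)) : ℚ)).IsElliptic := W₀.isElliptic_quadraticTwist hd0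
  haveI : ((W.quadraticTwist ((((-1 : ℤ) ^ (p / 2) * p : ℤ)) : ℚ)).quadraticTwist
      ((((-1 : ℤ) ^ (p / 2) * p : ℤ)) : ℚ)).IsElliptic :=
    (W.quadraticTwist ((((-1 : ℤ) ^ (p / 2) * p : ℤ)) : ℚ)).isElliptic_quadraticTwist hd0
  -- `W ∼ W₀ ⊗ p*`
  have htw : IsIsogenous W (W₀.quadraticTwist ((((-1 : ℤ) ^ (p / 2) * p : ℤ)) : ℚ)) := by
    obtain ⟨Cq, hCq⟩ := W.exists_variableChange_smul_eq_quadraticTwist_sq hd0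
    have h1 : IsIsogenous W ((W.quadraticTwist ((((-1 : ℤ) ^ (p / 2) * p : ℤ)) : ℚ)).quadraticTwist
        ((((-1 : ℤ) ^ (p / 2) * p : ℤ)) : ℚ)) := by
      rw [quadraticTwist_quadraticTwist, ← sq, ← hCq]
      exact isIsogenous_smul _ _
    exact h1.trans' (hiso.quadraticTwist hd0)
  -- twist-minimality of `W` at `p`: `p² ∣ N(W₀)`; hence `N(W₀) = N(W)`
  have hpN₀ : p ^ 2 ∣ W₀.conductorNorm ℤ := by
    by_contra h
    exact hodd ⟨W₀, p, hE₀, hM₀, hp, hp2, hpN, htw, h⟩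
  have hNN : W₀.conductorNorm ℤ = W.conductorNorm ℤ :=
    conductorNorm_eq_of_isIsogenous_twist_pStar_of_sq_dvd hnf h5 htw hpN hpN₀
  have hadd₀ : Addv W₀ p := not_good_and_not_mult_of_sq_dvd_conductorNorm W₀ hpN₀
  have hadd : Addv W p := not_good_and_not_mult_of_sq_dvd_conductorNorm W hpN
  -- globally minimal models `C` of `W ⊗ p*` and `C'` of `W₀ ⊗ p*`
  obtain ⟨u, hCmin⟩ := hasGlobalMinimalModel_rat_holds (W.quadraticTwist ((((-1 : ℤ) ^ (p / 2) * p : ℤ)) : ℚ))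
  set C : WeierstrassCurve ℚ := u • W.quadraticTwist ((((-1 : ℤ) ^ (p / 2) * p : ℤ)) : ℚ) with hCdef
  haveI : C.IsGloballyMinimal := hCmin
  obtain ⟨u', hC'min⟩ := hasGlobalMinimalModel_rat_holds (W₀.quadraticTwist ((((-1 : ℤ) ^ (p / 2) * p : ℤ)) : ℚ))
  set C' : WeierstrassCurve ℚ := u' • W₀.quadraticTwist ((((-1 : ℤ) ^ (p / 2) * p : ℤ)) : ℚ) with hC'def
  haveI : C'.IsGloballyMinimal := hC'min
  have hCW₀ : IsIsogenous C W₀ :=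
    (isIsogenous_smul (W.quadraticTwist ((((-1 : ℤ) ^ (p / 2) * p : ℤ)) : ℚ)) u).symm_of_charZero.trans' hiso
  have hWC' : IsIsogenous W C' :=
    htw.trans' (isIsogenous_smul (W₀.quadraticTwist ((((-1 : ℤ) ^ (p / 2) * p : ℤ)) : ℚ)) u')
  have hC'W : IsIsogenous C' W := hWC'.symm_of_charZero
  -- `ord_p j(W) ≥ 0` (no `Iₙ*` fibre) and `ord_p Δ_min(C') = ord_p Δ_min(W₀) + 6`
  have hAddC : Addv C p := by
    have hNC : C.conductorNorm ℤ = W₀.conductorNorm ℤ :=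
      conductorNorm_eq_of_isIsogenous_of_modularity
        (nonempty_modularParametrizationData_of_exists_isNewformOf hnf
          IsNewformOf.exists_maninConstant_ne_zero_holds) _ _ hCW₀
    exact not_good_and_not_mult_of_sq_dvd_conductorNorm C (by rw [hNC]; exact hpN₀)
  have hj : 0 ≤ padicValRat p W.j := padicValRat_j_nonneg_of_pStar_pair_addv hp2 u rfl hadd hAddC
  have hv₀6 : padicValInt p W₀.minimalDiscriminantInt < 6 := by omega
  have hv6 : padicValInt p W.minimalDiscriminantInt < 6 := by omega
  have hvC' : padicValInt p C'.minimalDiscriminantInt = padicValInt p W₀.minimalDiscriminantInt + 6 :=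
    padicValInt_minimalDiscriminantInt_twist_pm_p_of_lt_six p hp2 W₀ C' hv₀6 hd u' rfl
  -- the tame index is an isogeny invariant: `gcd(12, ord_p Δ_min(W₀) + 6) = gcd(12, 2)`, so the twin is IV
  have hgcd := TameDefectIsogenyInvariance.gcd_padicValInt_minimalDiscriminantInt_eq_of_isIsogenous
    (W := W) (W' := C') h5 hj hWC'
  rw [hvC', hv2] at hgcd
  -- the Kodaira symbol of `W₀` at `p`: additive with `ord_p Δ_min ≤ 4`, and the gcd pins it to IV
  have hv₀4 : padicValInt p W₀.minimalDiscriminantInt = 4 := by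
    rcases kodairaSymbolAt_placeOf_cases_of_addv W₀ p h5 hadd₀ with
      ⟨-, h⟩ | ⟨-, h⟩ | ⟨-, h⟩ | ⟨m, -, hm⟩ | ⟨-, h⟩ | ⟨-, h⟩ | ⟨-, h⟩
    · rw [h] at hgcd; norm_num at hgcd
    · rw [h] at hgcd; norm_num at hgcd
    · exact h
    · omega
    · omega
    · omega
    · omega
  have hI₀ : ∀ n : ℕ,
      W₀.kodairaSymbolAt ((Rat.HeightOneSpectrum.primesEquiv (R := ℤ)).symm ⟨p, hp⟩) ≠ .Istar n := by
    intro n hn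
    have hn' : W₀.kodairaSymbolAt (placeOf p) = .Istar n := hn
    rcases kodairaSymbolAt_placeOf_cases_of_addv W₀ p h5 hadd₀ with
      ⟨h, _⟩ | ⟨h, _⟩ | ⟨h, _⟩ | ⟨m, h, hm⟩ | ⟨h, _⟩ | ⟨h, _⟩ | ⟨h, _⟩
    · rw [hn'] at h; exact KodairaSymbol.noConfusion h
    · rw [hn'] at h; exact KodairaSymbol.noConfusion h
    · rw [hn'] at h; exact KodairaSymbol.noConfusion h
    · omega
    · rw [hn'] at h; exact KodairaSymbol.noConfusion h
    · rw [hn'] at h; exact KodairaSymbol.noConfusion h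
    · rw [hn'] at h; exact KodairaSymbol.noConfusion h
  -- `p ∤ c(D₀)`: by `hA` on the type-IV twin (or by ČNS when `p ∤ deg φ₀`)
  have h0 : ¬ (p : ℤ) ∣ D₀.maninConstant := by
    by_cases hdeg₀ : p ∣ D₀.modularDegree
    · have hred₀ : ¬ W₀.HasIrreducibleModPGaloisRep p := fun h ↦
        not_hasIrreducibleModPGaloisRep_of_isIsogenous htw hred
          ((hasIrreducibleModPGaloisRep_quadraticTwist_iff W₀ hd0 p).mpr h)
      exact hA hM hAU hC hnf W₀ D₀ hD₀ p hp h57 hpN₀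
        (oddTwistMinimal_of_isIsogenous_twist_pStar hnf hp2 htw hpN hNN hodd)
        (dyadicTwistMinimal_of_isIsogenous_twist_pStar hp2 htw hNN hdy)
        hred₀ (by rw [hNN]; exact hN) hdeg₀ hI₀ (by omega) (fun _ ↦ by omega)
    · exact not_dvd_maninConstant_of_not_dvd_modularDegree hCNS W₀ D₀ hp h5 hdeg₀
  -- the flip-orbit identity `c(D₀) = ±c(D)` (both optimal curves unstarred)
  have hΔC : C.Δ = ((((-1 : ℤ) ^ (p / 2) * p : ℤ)) : ℚ) ^ 6 * W.Δ :=
    Δ_eq_pStar_pow_six_mul_Δ_of_padicValInt_lt_six hp2 W C hv6 u rfl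
  have hΔC' : C'.Δ = ((((-1 : ℤ) ^ (p / 2) * p : ℤ)) : ℚ) ^ 6 * W₀.Δ :=
    Δ_eq_pStar_pow_six_mul_Δ_of_padicValInt_lt_six hp2 W₀ C' hv₀6 u' rfl
  have hcc : D₀.c = D.c ∨ D₀.c = -D.c :=
    flipOrbitManinEq_pStar hp hp2 W W₀ C C' u u' D D₀ hpN hNN rfl hCW₀ rfl hC'W hD hD₀ hΔC hΔC'
  intro hpc
  apply h0
  rcases hcc with h | h
  · rw [show D₀.maninConstant = D₀.c from rfl, h]; exact hpc
  · rw [show D₀.maninConstant = D₀.c from rfl, h]; exact (dvd_neg).mpr hpc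

end Summit.BirchSwinnertonDyer.BirchSwinnertonDyer.Theorems

end
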